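import Literature.Topology.FourManifolds.TorusSurgery
import Literature.Topology.FourManifolds.GluckTwistExistence
import Literature.Topology.FourManifolds.LinkSurgeryExistence
import HarnessLib

/-!
# Iwase's theorem "Gluck twists are torus surgeries": reduction to a model on `S² × ℝ²`

Sibling proof file of `TorusSurgery.lean` (fact seat
`provefact-Literature.Topology.FourManifolds.Iwase1988_gluckTwist_isTorusLinkSurgery`; D-0014/D-0026:
no definition, no new named fact, no `sorry`). It concerns the named fact
`Literature.Topology.FourManifolds.Iwase1988_gluckTwist_isTorusLinkSurgery` — Z. Iwase, *Dehn-surgery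
along a torus T²-knot*, Pacific J. Math. 133 (1988) 289–299, Prop. 3.5 (p. 296): *if a closed
4-manifold `M` is obtained by Gluck-surgery along an `S²`-knot in `S⁴`, then `M` is also obtained
by Dehn-surgery along a `T²`-knot in `S⁴`* — and proves its **reduction to a model problem in the
standard tube `S² × ℝ²`**, independent of the knot `K` and of the Gluck twist `X`.

## The reduction (`isTorusLinkSurgery_of_gluckTwist_of_model`, `iwase1988_of_model`)

`IsGluckTwist (𝓡 4) X K` (`GluckTwist.lean`) presents `X` as an open gluing of the knot complement
`S⁴ ∖ K(S²)` and of `S² × ℝ²` along the Gluck relation of a tubular neighbourhood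
`ν : S² × ℝ² ↪ S⁴`: open smooth embeddings `jA' : S⁴ ∖ K → X`, `jB' : S² × ℝ² → X` covering `X`
with `jA' (ν p) = jB' (gluckMapInv p)` for `p.2 ≠ 0` (`gluckMapInv (x, w) = (rot_{w̄/‖w‖} x, w)`,
`GluckTwistExistence.lean`). Iwase's proof (loc. cit. p. 297) changes nothing outside `ν`: the new
torus `K'` is `K` with a trivial 1-handle attached inside the tube, and the identification of the
torus surgery with `M` is the identity off the tube. Accordingly the whole theorem follows from a
**model datum on `S² × ℝ²`**: a matrix `A ∈ GL(3,ℤ)`; smooth embeddings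
`T₀, T₁ : T² × ℝ² → S² × ℝ²` (the framed model torus `Σ₀ = T₀ (T² × 0)`, which in the
construction contains `S² ∖ (polar caps)`, and the framed image torus `Σ₁`); and mutually inverse
`C^∞` maps `Φ : (S² × ℝ²) ∖ Σ₀ → (S² × ℝ²) ∖ Σ₁`, `Ψ` back, with `Φ = gluckMapInv` outside a
bounded set `{‖w‖ < R}` and with `Φ p = T₁ b` iff `b` is off the core and `p = T₀ (ψ_A b)` — the
fibre relation of `IsTorusLinkSurgery` written in the model. Given such a datum, for every 2-knot
`K` and every Gluck twist `X` of `S⁴` along `K`: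

* `T := ν ∘ T₀ : T² × ℝ² → S⁴` is the framed torus (an open smooth embedding, composition of open
  smooth embeddings of 4-manifolds, `isSmoothEmbedding_comp_of_isOpen_range`);
* `U := S⁴ ∖ ν(Σ₀)`, `jB := jB' ∘ T₁`, and `jA : U → X` is `jB' ∘ Φ ∘ ν⁻¹` on `ν(S² × ℝ²) ∩ U`
  and `jA'` elsewhere — the two agree on `ν {‖w‖ > R}` by the Gluck relation, since there
  `Φ = gluckMapInv`;
* `jA` is a smooth embedding with open range: near every point it agrees with a composite of
  partial diffeomorphisms (`Mathlib`'s `PartialDiffeomorph`: the inclusions of the open sets, `ν⁻¹`,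
  `Φ`, `jB'`, `jA'`), hence is an immersion
  (`isImmersionAtOfComplement_of_eventuallyEq_openPartialHomeomorph`, `SmoothEmbeddingCriteria.lean`)
  and an open map; it is injective because `jA'`-points off the tube are never `jB'`-points;
* `X = jA(U) ∪ jB(T² × ℝ²)`: a point `jB' q` is `jA (ν (Ψ q))` if `q ∉ Σ₁` and `jB b` if
  `q = T₁ (b)` on the core; a point `jA' (ν p)` is `jB' (gluckMapInv p)`;
* the fibre relation `jA a = jB b ↔ a = T (ψ_A b)` off the core is the model relation transported
  by `ν` and `jB'`.

Everything here is plumbing over the tree's gluing/embedding infrastructure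
(`GluckTwistExistence.lean`, `SmoothEmbeddingCriteria.lean`, `LinkSurgeryExistence.lean`,
`GluckTwistProofs.lean`); the geometric content of Iwase's theorem is thereby isolated in the model
datum, to be constructed in sibling files (design recorded in the seat's notes: polar rotation
model + one-handle slice model, after Iwase p. 297).

## References

* Z. Iwase, *Dehn-surgery along a torus T²-knot*, Pacific J. Math. 133 (1988) 289–299,
  Prop. 3.5 and its proof, pp. 296–297. doi:10.2140/pjm.1988.133.289 [Iwase1988]
* H. Gluck, *The embedding of two-spheres in the four-sphere*, Trans. AMS 104 (1962) 308–333, §8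
  [GluckTAMS1962].
* K. Larson, *Surgery on tori in the 4-sphere*, Math. Proc. Cambridge Philos. Soc. (2018), §§1–2
  [Larson2016].
* J. M. Lee, *Introduction to Smooth Manifolds* (2013), Prop. 5.2, Thm. 4.14 (open embeddings).

## Design notes

* No `def` is introduced: the partial diffeomorphisms of the pieces are produced by existence
  theorems (`exists_partialDiffeomorph_opens`, `exists_partialDiffeomorph_of_isOpen_range`) and the
  one for `Φ` is an anonymous structure instance inside the proof.
* The fibre relation is kept LITERALLY in the shape of `IsTorusLinkSurgery` (four real parameters
  `θ₁ θ₂ θ₃ t`), so that the conclusion is the vendored statement by `rfl`-transport along `ν`.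
* No declaration in this file uses `sorry`.
-/

open scoped Manifold ContDiff Topology
open Function Set

noncomputable section

namespace Literature.Topology.FourManifolds

/-! ### Partial diffeomorphisms of the pieces (Mathlib's `PartialDiffeomorph`) -/

section Pieces

variable {E H : Type*} [NormedAddCommGroup E] [NormedSpace ℝ E] [TopologicalSpace H]
  {I : ModelWithCorners ℝ E H} {M : Type*} [TopologicalSpace M] [ChartedSpace H M]
  {E' H' : Type*} [NormedAddCommGroup E'] [NormedSpace ℝ E'] [TopologicalSpace H']
  {J : ModelWithCorners ℝ E' H'} {N : Type*} [TopologicalSpace N] [ChartedSpace H' N]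
  {E₃ H₃ : Type*} [NormedAddCommGroup E₃] [NormedSpace ℝ E₃] [TopologicalSpace H₃]
  {I₃ : ModelWithCorners ℝ E₃ H₃} {P : Type*} [TopologicalSpace P] [ChartedSpace H₃ P]

/-- A composite of partial diffeomorphisms is the composite map. [folklore] -/
theorem PartialDiffeomorph.trans_apply (e : PartialDiffeomorph I J M N ∞)
    (e' : PartialDiffeomorph J I₃ N P ∞) (x : M) : e.trans e' x = e' (e x) := rfl

/-- The source of a composite of partial diffeomorphisms. [folklore] -/
theorem PartialDiffeomorph.trans_source (e : PartialDiffeomorph I J M N ∞)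
    (e' : PartialDiffeomorph J I₃ N P ∞) : (e.trans e').source = e.source ∩ e ⁻¹' e'.source := rfl

/-- The source of the inverse of a partial diffeomorphism is its target. [folklore] -/
theorem PartialDiffeomorph.symm_source (e : PartialDiffeomorph I J M N ∞) :
    e.symm.source = e.target := rfl

/-- **The inclusion of an open subset is a partial diffeomorphism** `U ⇀ M` with source `univ` and
target `U`: `Subtype.val` is `C^∞` (`contMDiff_subtype_val`) and its inverse is `C^∞` on `U`
(a map into the open submanifold `U` is `C^∞` iff its composite with the inclusion is,
`ContMDiffWithinAt.subtypeVal_comp_iff`). Lee (2013), Ch. 1 (open submanifolds). [folklore] -/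
theorem exists_partialDiffeomorph_opens [IsManifold I ∞ M] (U : TopologicalSpace.Opens M)
    (hU : Nonempty U) : ∃ e : PartialDiffeomorph I I U M ∞, e.source = univ ∧
      e.target = (U : Set M) ∧ (∀ u : U, e u = u) ∧ ∀ u : U, e.symm (u : M) = u := by
  refine ⟨{ toPartialEquiv := (U.openPartialHomeomorphSubtypeCoe hU).toPartialEquiv
            open_source := (U.openPartialHomeomorphSubtypeCoe hU).open_source
            open_target := (U.openPartialHomeomorphSubtypeCoe hU).open_target
            contMDiffOn_toFun := ?_
            contMDiffOn_invFun := ?_ }, rfl,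
    TopologicalSpace.Opens.openPartialHomeomorphSubtypeCoe_target U hU, fun u => rfl, fun u =>
      (U.openPartialHomeomorphSubtypeCoe hU).left_inv (by simp)⟩
  · show ContMDiffOn I I ∞ (U.openPartialHomeomorphSubtypeCoe hU)
      (U.openPartialHomeomorphSubtypeCoe hU).source
    rw [TopologicalSpace.Opens.openPartialHomeomorphSubtypeCoe_coe]
    exact contMDiff_subtype_val.contMDiffOn
  · show ContMDiffOn I I ∞ (U.openPartialHomeomorphSubtypeCoe hU).symm
      (U.openPartialHomeomorphSubtypeCoe hU).target
    rw [TopologicalSpace.Opens.openPartialHomeomorphSubtypeCoe_target]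
    intro y hy
    rw [← ContMDiffWithinAt.subtypeVal_comp_iff]
    refine (contMDiffWithinAt_id (I := I) (n := ∞)).congr (fun y' hy' => ?_) ?_
    · exact (U.openPartialHomeomorphSubtypeCoe hU).right_inv
        (by rwa [TopologicalSpace.Opens.openPartialHomeomorphSubtypeCoe_target])
    · exact (U.openPartialHomeomorphSubtypeCoe hU).right_inv
        (by rwa [TopologicalSpace.Opens.openPartialHomeomorphSubtypeCoe_target])

/-- **An open smooth embedding is a partial diffeomorphism onto its range** (source `univ`): it is
`C^∞`, and its inverse is `C^∞` on the open range (`contMDiffOn_symm_of_isSmoothEmbedding`, the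
inverse function theorem in immersion charts). Lee (2013), Prop. 5.2 / Thm. 4.14. [folklore] -/
theorem exists_partialDiffeomorph_of_isOpen_range [Nonempty M] {f : M → N}
    (hf : Manifold.IsSmoothEmbedding I J ∞ f) (ho : IsOpen (range f)) :
    ∃ e : PartialDiffeomorph I J M N ∞, e.source = univ ∧ e.target = range f ∧ (∀ x, e x = f x) ∧
      ∀ x, e.symm (f x) = x := by
  have hfe : Topology.IsOpenEmbedding f := .mk hf.isEmbedding ho
  refine ⟨{ toPartialEquiv := (hfe.toOpenPartialHomeomorph f).toPartialEquiv
            open_source := (hfe.toOpenPartialHomeomorph f).open_source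
            open_target := (hfe.toOpenPartialHomeomorph f).open_target
            contMDiffOn_toFun := hf.contMDiff.contMDiffOn
            contMDiffOn_invFun := ?_ },
    Topology.IsOpenEmbedding.toOpenPartialHomeomorph_source f hfe,
    Topology.IsOpenEmbedding.toOpenPartialHomeomorph_target f hfe, fun x => rfl, fun x =>
      Topology.IsOpenEmbedding.toOpenPartialHomeomorph_left_inv f (h := hfe)⟩
  show ContMDiffOn J I ∞ (hfe.toOpenPartialHomeomorph f).symm (hfe.toOpenPartialHomeomorph f).target
  rw [Topology.IsOpenEmbedding.toOpenPartialHomeomorph_target]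
  exact contMDiffOn_symm_of_isSmoothEmbedding hf _

end Pieces

/-! ### The reduction of Iwase's theorem to a model datum on `S² × ℝ²` -/

section Reduction

universe u

variable {A : Matrix (Fin 3) (Fin 3) ℤ}

/-- **Iwase's theorem for one Gluck twist, from a model datum on the tube.** Let `A ∈ GL(3,ℤ)`,
let `T₀ T₁ : T² × ℝ² → S² × ℝ²` be smooth embeddings with core tori `Σ₀ = T₀(T² × 0)`,
`Σ₁ = T₁(T² × 0)`, and let `Φ`, `Ψ` be `C^∞` on `Σ₀ᶜ`, `Σ₁ᶜ` and mutually inverse between them,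
with `Φ = gluckMapInv` on `{R ≤ ‖w‖}` and `Φ p = T₁ b ↔ (b off the core ∧ p = T₀ (ψ_A b))` for
`p ∉ Σ₀` (the fibre relation of `IsTorusLinkSurgery` in the model). Then every Gluck twist `X` of
`S⁴` along any 2-knot `K` is a torus surgery on `S⁴` along the single framed torus `T = ν ∘ T₀`
with matrix `A` (`ν` the tubular neighbourhood of the Gluck gluing): `U = S⁴ ∖ ν(Σ₀)`,
`jA = jB' ∘ Φ ∘ ν⁻¹` on the tube and `jA'` off it, `jB = jB' ∘ T₁` (module docstring). This is the
K- and X-independent form of Iwase's argument, which modifies the Gluck identification only inside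
the tubular neighbourhood. [cite: Iwase1988, Prop. 3.5 (proof, p. 297)] -/
theorem isTorusLinkSurgery_of_gluckTwist_of_model (hA : A.det = 1 ∨ A.det = -1)
    {T₀ T₁ : (((Metric.sphere (0 : EuclideanSpace ℝ (Fin 2)) 1)) × ((Metric.sphere (0 : EuclideanSpace ℝ (Fin 2)) 1))) × (EuclideanSpace ℝ (Fin 2)) → ((Metric.sphere (0 : EuclideanSpace ℝ (Fin 3)) 1)) × (EuclideanSpace ℝ (Fin 2))}
    (hT₀ : Manifold.IsSmoothEmbedding (((𝓡 1).prod (𝓡 1)).prod 𝓘(ℝ, (EuclideanSpace ℝ (Fin 2))))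
      ((𝓡 2).prod 𝓘(ℝ, (EuclideanSpace ℝ (Fin 2)))) ∞ T₀)
    (hT₁ : Manifold.IsSmoothEmbedding (((𝓡 1).prod (𝓡 1)).prod 𝓘(ℝ, (EuclideanSpace ℝ (Fin 2))))
      ((𝓡 2).prod 𝓘(ℝ, (EuclideanSpace ℝ (Fin 2)))) ∞ T₁)
    {Φ Ψ : ((Metric.sphere (0 : EuclideanSpace ℝ (Fin 3)) 1)) × (EuclideanSpace ℝ (Fin 2)) → ((Metric.sphere (0 : EuclideanSpace ℝ (Fin 3)) 1)) × (EuclideanSpace ℝ (Fin 2))}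
    (hΦ : ContMDiffOn ((𝓡 2).prod 𝓘(ℝ, (EuclideanSpace ℝ (Fin 2)))) ((𝓡 2).prod 𝓘(ℝ, (EuclideanSpace ℝ (Fin 2)))) ∞ Φ
      (range fun x : ((Metric.sphere (0 : EuclideanSpace ℝ (Fin 2)) 1)) × ((Metric.sphere (0 : EuclideanSpace ℝ (Fin 2)) 1)) => T₀ (x, 0))ᶜ)
    (hΨ : ContMDiffOn ((𝓡 2).prod 𝓘(ℝ, (EuclideanSpace ℝ (Fin 2)))) ((𝓡 2).prod 𝓘(ℝ, (EuclideanSpace ℝ (Fin 2)))) ∞ Ψ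
      (range fun x : ((Metric.sphere (0 : EuclideanSpace ℝ (Fin 2)) 1)) × ((Metric.sphere (0 : EuclideanSpace ℝ (Fin 2)) 1)) => T₁ (x, 0))ᶜ)
    (hΦΨ : ∀ p, p ∉ range (fun x : ((Metric.sphere (0 : EuclideanSpace ℝ (Fin 2)) 1)) × ((Metric.sphere (0 : EuclideanSpace ℝ (Fin 2)) 1)) => T₀ (x, 0)) →
      Φ p ∉ range (fun x : ((Metric.sphere (0 : EuclideanSpace ℝ (Fin 2)) 1)) × ((Metric.sphere (0 : EuclideanSpace ℝ (Fin 2)) 1)) => T₁ (x, 0)) ∧ Ψ (Φ p) = p)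
    (hΨΦ : ∀ q, q ∉ range (fun x : ((Metric.sphere (0 : EuclideanSpace ℝ (Fin 2)) 1)) × ((Metric.sphere (0 : EuclideanSpace ℝ (Fin 2)) 1)) => T₁ (x, 0)) →
      Ψ q ∉ range (fun x : ((Metric.sphere (0 : EuclideanSpace ℝ (Fin 2)) 1)) × ((Metric.sphere (0 : EuclideanSpace ℝ (Fin 2)) 1)) => T₀ (x, 0)) ∧ Φ (Ψ q) = q)
    (hfar : ∃ R : ℝ, ∀ p : ((Metric.sphere (0 : EuclideanSpace ℝ (Fin 3)) 1)) × (EuclideanSpace ℝ (Fin 2)), R ≤ ‖p.2‖ → Φ p = gluckMapInv p)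
    (hrel : ∀ p, p ∉ range (fun x : ((Metric.sphere (0 : EuclideanSpace ℝ (Fin 2)) 1)) × ((Metric.sphere (0 : EuclideanSpace ℝ (Fin 2)) 1)) => T₀ (x, 0)) →
      ∀ b : (((Metric.sphere (0 : EuclideanSpace ℝ (Fin 2)) 1)) × ((Metric.sphere (0 : EuclideanSpace ℝ (Fin 2)) 1))) × (EuclideanSpace ℝ (Fin 2)), (Φ p = T₁ b ↔ ∃ θ₁ θ₂ θ₃ t : ℝ, 0 < t ∧
        b = ((circlePoint θ₁, circlePoint θ₂), t • ((circlePoint θ₃ : (Metric.sphere (0 : EuclideanSpace ℝ (Fin 2)) 1)) : (EuclideanSpace ℝ (Fin 2)))) ∧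
        p = T₀ ((circlePoint ((A 0 0 : ℝ) * θ₁ + (A 0 1 : ℝ) * θ₂ + (A 0 2 : ℝ) * θ₃),
          circlePoint ((A 1 0 : ℝ) * θ₁ + (A 1 1 : ℝ) * θ₂ + (A 1 2 : ℝ) * θ₃)),
          t • ((circlePoint ((A 2 0 : ℝ) * θ₁ + (A 2 1 : ℝ) * θ₂ + (A 2 2 : ℝ) * θ₃) : (Metric.sphere (0 : EuclideanSpace ℝ (Fin 2)) 1)) :
            (EuclideanSpace ℝ (Fin 2))))))
    {K : TwoKnot} {X : Type*} [TopologicalSpace X] [ChartedSpace ((EuclideanSpace ℝ (Fin 4))) X]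
    [IsManifold (𝓡 4) ∞ X] (hX : IsGluckTwist (𝓡 4) X K) :
    ∃ (T : (((Metric.sphere (0 : EuclideanSpace ℝ (Fin 2)) 1)) × ((Metric.sphere (0 : EuclideanSpace ℝ (Fin 2)) 1))) × (EuclideanSpace ℝ (Fin 2)) → (Metric.sphere (0 : EuclideanSpace ℝ (Fin 5)) 1)) (A : Matrix (Fin 3) (Fin 3) ℤ),
      IsTorusLinkSurgery (𝓡 4) X 1 (fun _ => T) (fun _ => A) := by
  classical
  obtain ⟨ν, jA', jB', hA', hA'o, hB', hB'o, hcov, hR⟩ := hX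
  obtain ⟨R, hfarR⟩ := hfar
  -- the model tori
  set S₀ : Set (((Metric.sphere (0 : EuclideanSpace ℝ (Fin 3)) 1)) × (EuclideanSpace ℝ (Fin 2))) := range fun x : ((Metric.sphere (0 : EuclideanSpace ℝ (Fin 2)) 1)) × ((Metric.sphere (0 : EuclideanSpace ℝ (Fin 2)) 1)) => T₀ (x, 0) with hS₀
  set S₁ : Set (((Metric.sphere (0 : EuclideanSpace ℝ (Fin 3)) 1)) × (EuclideanSpace ℝ (Fin 2))) := range fun x : ((Metric.sphere (0 : EuclideanSpace ℝ (Fin 2)) 1)) × ((Metric.sphere (0 : EuclideanSpace ℝ (Fin 2)) 1)) => T₁ (x, 0) with hS₁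
  have hc₀ : Continuous fun x : ((Metric.sphere (0 : EuclideanSpace ℝ (Fin 2)) 1)) × ((Metric.sphere (0 : EuclideanSpace ℝ (Fin 2)) 1)) => T₀ (x, 0) :=
    hT₀.contMDiff.continuous.comp (continuous_id.prodMk continuous_const)
  have hc₁ : Continuous fun x : ((Metric.sphere (0 : EuclideanSpace ℝ (Fin 2)) 1)) × ((Metric.sphere (0 : EuclideanSpace ℝ (Fin 2)) 1)) => T₁ (x, 0) :=
    hT₁.contMDiff.continuous.comp (continuous_id.prodMk continuous_const)
  have hS₀c : IsCompact S₀ := isCompact_range hc₀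
  have hS₁c : IsCompact S₁ := isCompact_range hc₁
  -- a radius beyond the model torus and the modification region
  obtain ⟨C, hC⟩ : ∃ C : ℝ, ∀ p ∈ S₀, ‖p.2‖ ≤ C := by
    obtain ⟨C, hC⟩ := hS₀c.bddAbove_image (f := fun p => ‖p.2‖) (by fun_prop : Continuous
      fun p : ((Metric.sphere (0 : EuclideanSpace ℝ (Fin 3)) 1)) × (EuclideanSpace ℝ (Fin 2)) => ‖p.2‖).continuousOn
    exact ⟨C, fun p hp => hC (mem_image_of_mem _ hp)⟩
  set R' : ℝ := |R| + |C| + 1 with hR'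
  have hR'pos : 0 < R' := by positivity
  have hfar' : ∀ p : ((Metric.sphere (0 : EuclideanSpace ℝ (Fin 3)) 1)) × (EuclideanSpace ℝ (Fin 2)), R' ≤ ‖p.2‖ → Φ p = gluckMapInv p := fun p hp =>
    hfarR p ((le_abs_self R).trans (by linarith [abs_nonneg C]))
  have hfar_ne : ∀ p : ((Metric.sphere (0 : EuclideanSpace ℝ (Fin 3)) 1)) × (EuclideanSpace ℝ (Fin 2)), R' ≤ ‖p.2‖ → p.2 ≠ 0 := fun p hp h0 => by
    rw [h0, norm_zero] at hp; linarith
  have hfar_notMem : ∀ p : ((Metric.sphere (0 : EuclideanSpace ℝ (Fin 3)) 1)) × (EuclideanSpace ℝ (Fin 2)), R' ≤ ‖p.2‖ → p ∉ S₀ := fun p hp hmem => by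
    have := hC p hmem; rw [hR'] at hp; linarith [le_abs_self C, abs_nonneg R]
  -- the framed torus in `S⁴`
  set T : (((Metric.sphere (0 : EuclideanSpace ℝ (Fin 2)) 1)) × ((Metric.sphere (0 : EuclideanSpace ℝ (Fin 2)) 1))) × (EuclideanSpace ℝ (Fin 2)) → (Metric.sphere (0 : EuclideanSpace ℝ (Fin 5)) 1) := ν.toFun ∘ T₀ with hT
  have hcore : range (fun x : ((Metric.sphere (0 : EuclideanSpace ℝ (Fin 2)) 1)) × ((Metric.sphere (0 : EuclideanSpace ℝ (Fin 2)) 1)) => T (x, 0)) = ν.toFun '' S₀ := by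
    rw [hS₀, ← range_comp]; rfl
  have hcorec : IsClosed (range fun x : ((Metric.sphere (0 : EuclideanSpace ℝ (Fin 2)) 1)) × ((Metric.sphere (0 : EuclideanSpace ℝ (Fin 2)) 1)) => T (x, 0)) := by
    rw [hcore]; exact (hS₀c.image ν.continuous).isClosed
  set U : TopologicalSpace.Opens ((Metric.sphere (0 : EuclideanSpace ℝ (Fin 5)) 1)) :=
    ⟨(⋃ i : Fin 1, range fun x : ((Metric.sphere (0 : EuclideanSpace ℝ (Fin 2)) 1)) × ((Metric.sphere (0 : EuclideanSpace ℝ (Fin 2)) 1)) => T (x, 0))ᶜ, by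
      rw [iUnion_const]; exact hcorec.isOpen_compl⟩ with hU
  have hmemU : ∀ {a : (Metric.sphere (0 : EuclideanSpace ℝ (Fin 5)) 1)}, a ∈ U ↔ a ∉ ν.toFun '' S₀ := fun {a} => by
    show a ∈ (⋃ i : Fin 1, range fun x : ((Metric.sphere (0 : EuclideanSpace ℝ (Fin 2)) 1)) × ((Metric.sphere (0 : EuclideanSpace ℝ (Fin 2)) 1)) => T (x, 0))ᶜ ↔ _
    rw [iUnion_const, hcore, mem_compl_iff]
  have hνmemU : ∀ {p : ((Metric.sphere (0 : EuclideanSpace ℝ (Fin 3)) 1)) × (EuclideanSpace ℝ (Fin 2))}, ν.toFun p ∈ U ↔ p ∉ S₀ := fun {p} => by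
    rw [hmemU, ν.injective.mem_set_image]
  -- membership in the knot complement
  have hKc_of_not_mem : ∀ {a : (Metric.sphere (0 : EuclideanSpace ℝ (Fin 5)) 1)}, a ∉ range ν.toFun → a ∈ K.complement := fun ha hK =>
    ha (ν.range_subset_range hK)
  have hKc_of_ne : ∀ {p : ((Metric.sphere (0 : EuclideanSpace ℝ (Fin 3)) 1)) × (EuclideanSpace ℝ (Fin 2))}, p.2 ≠ 0 → ν.toFun p ∈ K.complement := fun {p} hp =>
    ν.apply_mem_compl_range p.1 hp
  -- the Gluck identification on the punctured tube
  have hglue : ∀ {p : ((Metric.sphere (0 : EuclideanSpace ℝ (Fin 3)) 1)) × (EuclideanSpace ℝ (Fin 2))} (hp : p.2 ≠ 0), jA' ⟨ν.toFun p, hKc_of_ne hp⟩ =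
      jB' (gluckMapInv p) := fun {p} hp => by
    rw [hR]
    refine ⟨by rwa [gluckMapInv_snd], ?_⟩
    show ν.toFun p = ν.toFun (gluckMap (gluckMapInv p))
    rw [gluckMap_gluckMapInv hp]
  -- the new charts
  let jA : U → X := fun u =>
    if h : (u : (Metric.sphere (0 : EuclideanSpace ℝ (Fin 5)) 1)) ∈ range ν.toFun then jB' (Φ (ν.toHomeo.symm u))
    else jA' ⟨u, hKc_of_not_mem h⟩
  set jB : (((Metric.sphere (0 : EuclideanSpace ℝ (Fin 2)) 1)) × ((Metric.sphere (0 : EuclideanSpace ℝ (Fin 2)) 1))) × (EuclideanSpace ℝ (Fin 2)) → X := jB' ∘ T₁ with hjB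
  have hjA_ν : ∀ {p : ((Metric.sphere (0 : EuclideanSpace ℝ (Fin 3)) 1)) × (EuclideanSpace ℝ (Fin 2))} (hp : ν.toFun p ∈ U), jA ⟨ν.toFun p, hp⟩ = jB' (Φ p) :=
    fun {p} hp => by
    show (if h : ν.toFun p ∈ range ν.toFun then jB' (Φ (ν.toHomeo.symm (ν.toFun p)))
      else _) = _
    rw [dif_pos (mem_range_self p), ν.toHomeo_symm_apply]
  have hjA_out : ∀ {u : U} (hu : (u : (Metric.sphere (0 : EuclideanSpace ℝ (Fin 5)) 1)) ∉ range ν.toFun),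
      jA u = jA' ⟨u, hKc_of_not_mem hu⟩ := fun {u} hu => dif_neg hu
  -- far from the torus both descriptions agree
  set Far : Set ((Metric.sphere (0 : EuclideanSpace ℝ (Fin 5)) 1)) := (ν.toFun '' (univ ×ˢ Metric.closedBall (0 : (EuclideanSpace ℝ (Fin 2))) R'))ᶜ with hFar
  have hFaro : IsOpen Far :=
    ((isCompact_univ.prod (isCompact_closedBall _ _)).image ν.continuous).isClosed.isOpen_compl
  have hFar_of_not_mem : ∀ {a : (Metric.sphere (0 : EuclideanSpace ℝ (Fin 5)) 1)}, a ∉ range ν.toFun → a ∈ Far := fun {a} ha hmem => by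
    obtain ⟨p, -, rfl⟩ := hmem
    exact ha (mem_range_self p)
  have hFar_ν : ∀ {p : ((Metric.sphere (0 : EuclideanSpace ℝ (Fin 3)) 1)) × (EuclideanSpace ℝ (Fin 2))}, ν.toFun p ∈ Far ↔ R' < ‖p.2‖ := fun {p} => by
    rw [hFar, mem_compl_iff, ν.injective.mem_set_image]
    simp [not_le]
  have hFarKc : ∀ {a : (Metric.sphere (0 : EuclideanSpace ℝ (Fin 5)) 1)}, a ∈ Far → a ∈ K.complement := fun {a} ha => by
    by_cases hmem : a ∈ range ν.toFun
    · obtain ⟨p, rfl⟩ := hmem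
      exact hKc_of_ne (hfar_ne p (hFar_ν.1 ha).le)
    · exact hKc_of_not_mem hmem
  have hjA_far : ∀ {u : U} (hu : (u : (Metric.sphere (0 : EuclideanSpace ℝ (Fin 5)) 1)) ∈ Far), jA u = jA' ⟨u, hFarKc hu⟩ := fun {u} hu => by
    by_cases hmem : (u : (Metric.sphere (0 : EuclideanSpace ℝ (Fin 5)) 1)) ∈ range ν.toFun
    · obtain ⟨p, hp⟩ := hmem
      have hpU : ν.toFun p ∈ U := hp ▸ u.2
      have h1 : jA u = jA ⟨ν.toFun p, hpU⟩ := by congr 1; exact Subtype.ext hp.symm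
      have hpR : R' ≤ ‖p.2‖ := (hFar_ν.1 (hp ▸ hu)).le
      rw [h1, hjA_ν hpU, hfar' p hpR, ← hglue (hfar_ne p hpR)]
      congr 1
      exact Subtype.ext hp
    · exact hjA_out hmem
  -- a far point: the pieces are nonempty
  obtain ⟨p₀, hp₀⟩ : ∃ p₀ : ((Metric.sphere (0 : EuclideanSpace ℝ (Fin 3)) 1)) × (EuclideanSpace ℝ (Fin 2)), R' < ‖p₀.2‖ := by
    obtain ⟨w, hw⟩ := NormedSpace.exists_lt_norm ℝ ((EuclideanSpace ℝ (Fin 2))) R'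
    exact ⟨(⟨EuclideanSpace.single 0 1, by simp⟩, w), hw⟩
  have hp₀U : ν.toFun p₀ ∈ U := hνmemU.2 (hfar_notMem p₀ hp₀.le)
  haveI hUne : Nonempty U := ⟨⟨_, hp₀U⟩⟩
  haveI hKne : Nonempty K.complement := ⟨⟨_, hKc_of_ne (hfar_ne p₀ hp₀.le)⟩⟩
  -- the partial diffeomorphisms of the pieces
  obtain ⟨pdU, hpdU_src, hpdU_tgt, hpdU_apply, -⟩ :=
    exists_partialDiffeomorph_opens (I := 𝓡 4) U hUne
  obtain ⟨pdK, -, hpdK_tgt, -, hpdK_symm⟩ :=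
    exists_partialDiffeomorph_opens (I := 𝓡 4) K.complement hKne
  obtain ⟨pdν, -, hpdν_tgt, -, hpdν_symm⟩ :=
    exists_partialDiffeomorph_of_isOpen_range ν.isSmoothEmbedding ν.isOpen_range
  obtain ⟨pdB, hpdB_src, -, hpdB_apply, -⟩ := exists_partialDiffeomorph_of_isOpen_range hB' hB'o
  obtain ⟨pdA, hpdA_src, -, hpdA_apply, -⟩ := exists_partialDiffeomorph_of_isOpen_range hA' hA'o
  let pdΦ : PartialDiffeomorph ((𝓡 2).prod 𝓘(ℝ, (EuclideanSpace ℝ (Fin 2)))) ((𝓡 2).prod 𝓘(ℝ, (EuclideanSpace ℝ (Fin 2)))) (((Metric.sphere (0 : EuclideanSpace ℝ (Fin 3)) 1)) × (EuclideanSpace ℝ (Fin 2)))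
      (((Metric.sphere (0 : EuclideanSpace ℝ (Fin 3)) 1)) × (EuclideanSpace ℝ (Fin 2))) ∞ :=
    { toFun := Φ
      invFun := Ψ
      source := S₀ᶜ
      target := S₁ᶜ
      map_source' := fun p hp => (hΦΨ p hp).1
      map_target' := fun q hq => (hΨΦ q hq).1
      left_inv' := fun p hp => (hΦΨ p hp).2
      right_inv' := fun q hq => (hΨΦ q hq).2
      open_source := hS₀c.isClosed.isOpen_compl
      open_target := hS₁c.isClosed.isOpen_compl
      contMDiffOn_toFun := hΦ
      contMDiffOn_invFun := hΨ }
  let e₁ : PartialDiffeomorph (𝓡 4) (𝓡 4) U X ∞ := pdU.trans (pdK.symm.trans pdA)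
  let e₂ : PartialDiffeomorph (𝓡 4) (𝓡 4) U X ∞ := pdU.trans (pdν.symm.trans (pdΦ.trans pdB))
  have he₁ : ∀ {u : U} (hu : (u : (Metric.sphere (0 : EuclideanSpace ℝ (Fin 5)) 1)) ∈ Far), u ∈ e₁.source ∧ jA =ᶠ[𝓝 u] e₁ := fun {u} hu => by
    have key : ∀ u' : U, (u' : (Metric.sphere (0 : EuclideanSpace ℝ (Fin 5)) 1)) ∈ Far → u' ∈ e₁.source ∧ jA u' = e₁ u' := fun u' hu' => by
      have hval : pdK.symm (u' : (Metric.sphere (0 : EuclideanSpace ℝ (Fin 5)) 1)) = ⟨u', hFarKc hu'⟩ := hpdK_symm ⟨u', hFarKc hu'⟩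
      refine ⟨?_, ?_⟩
      · rw [PartialDiffeomorph.trans_source, hpdU_src, univ_inter, mem_preimage, hpdU_apply,
          PartialDiffeomorph.trans_source, PartialDiffeomorph.symm_source, hpdK_tgt]
        exact ⟨hFarKc hu', by rw [mem_preimage, hval, hpdA_src]; exact mem_univ _⟩
      · rw [PartialDiffeomorph.trans_apply, hpdU_apply, PartialDiffeomorph.trans_apply, hval, hpdA_apply]
        exact hjA_far hu'
    refine ⟨(key u hu).1, ?_⟩
    filter_upwards [(hFaro.preimage continuous_subtype_val).mem_nhds hu] with u' hu'
    exact (key u' hu').2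
  have he₂ : ∀ {u : U} (hu : (u : (Metric.sphere (0 : EuclideanSpace ℝ (Fin 5)) 1)) ∈ range ν.toFun), u ∈ e₂.source ∧ jA =ᶠ[𝓝 u] e₂ :=
      fun {u} hu => by
    have key : ∀ u' : U, (u' : (Metric.sphere (0 : EuclideanSpace ℝ (Fin 5)) 1)) ∈ range ν.toFun → u' ∈ e₂.source ∧ jA u' = e₂ u' := by
      rintro ⟨_, hu'U⟩ ⟨p, rfl⟩
      have hpS : p ∉ S₀ := hνmemU.1 hu'U
      refine ⟨?_, ?_⟩
      · rw [PartialDiffeomorph.trans_source, hpdU_src, univ_inter, mem_preimage, hpdU_apply,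
          PartialDiffeomorph.trans_source, PartialDiffeomorph.symm_source, hpdν_tgt]
        refine ⟨mem_range_self p, ?_⟩
        rw [mem_preimage, hpdν_symm, PartialDiffeomorph.trans_source]
        exact ⟨hpS, by rw [mem_preimage, hpdB_src]; exact mem_univ _⟩
      · rw [PartialDiffeomorph.trans_apply, hpdU_apply, PartialDiffeomorph.trans_apply, hpdν_symm,
          PartialDiffeomorph.trans_apply, hpdB_apply]
        exact hjA_ν hu'U
    refine ⟨(key u hu).1, ?_⟩
    filter_upwards [(ν.isOpen_range.preimage continuous_subtype_val).mem_nhds hu] with u' hu'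
    exact (key u' hu').2
  have hloc : ∀ u : U, ∃ e : PartialDiffeomorph (𝓡 4) (𝓡 4) U X ∞, u ∈ e.source ∧ jA =ᶠ[𝓝 u] e :=
    fun u => by
    by_cases hu : (u : (Metric.sphere (0 : EuclideanSpace ℝ (Fin 5)) 1)) ∈ range ν.toFun
    · exact ⟨e₂, he₂ hu⟩
    · exact ⟨e₁, he₁ (hFar_of_not_mem hu)⟩
  -- `jA` is an immersion, continuous, open and injective
  have himmA : Manifold.IsImmersion (𝓡 4) (𝓡 4) ∞ jA :=
    Manifold.IsImmersionOfComplement.isImmersion (F := Unit) fun u => by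
      obtain ⟨e, hue, heq⟩ := hloc u
      exact isImmersionAtOfComplement_of_eventuallyEq_openPartialHomeomorph
        e.toOpenPartialHomeomorph e.contMDiffOn_toFun e.contMDiffOn_invFun
        (ContinuousLinearEquiv.refl ℝ ((EuclideanSpace ℝ (Fin 4)))) hue heq
  have hcontA : Continuous jA := himmA.contMDiff.continuous
  have hopenA : IsOpenMap jA := isOpenMap_iff_nhds_le.2 fun u => by
    obtain ⟨e, hue, heq⟩ := hloc u
    calc 𝓝 (jA u) = 𝓝 (e u) := by rw [heq.eq_of_nhds]
      _ = Filter.map e (𝓝 u) := (e.toOpenPartialHomeomorph.map_nhds_eq hue).symm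
      _ = Filter.map jA (𝓝 u) := (Filter.map_congr heq).symm
      _ ≤ Filter.map jA (𝓝 u) := le_rfl
  have hinjA : Injective jA := by
    rintro ⟨a₁, ha₁⟩ ⟨a₂, ha₂⟩ h
    by_cases h₁ : a₁ ∈ range ν.toFun <;> by_cases h₂ : a₂ ∈ range ν.toFun
    · obtain ⟨p₁, rfl⟩ := h₁
      obtain ⟨p₂, rfl⟩ := h₂
      rw [hjA_ν ha₁, hjA_ν ha₂] at h
      have h' := congrArg Ψ (hB'.isEmbedding.injective h)
      rw [(hΦΨ p₁ (hνmemU.1 ha₁)).2, (hΦΨ p₂ (hνmemU.1 ha₂)).2] at h'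
      subst h'
      rfl
    · exfalso
      obtain ⟨p₁, rfl⟩ := h₁
      rw [hjA_ν ha₁, hjA_out (u := ⟨a₂, ha₂⟩) h₂, eq_comm, hR] at h
      exact h₂ ⟨_, h.2.symm⟩
    · exfalso
      obtain ⟨p₂, rfl⟩ := h₂
      rw [hjA_ν ha₂, hjA_out (u := ⟨a₁, ha₁⟩) h₁, hR] at h
      exact h₁ ⟨_, h.2.symm⟩
    · rw [hjA_out (u := ⟨a₁, ha₁⟩) h₁, hjA_out (u := ⟨a₂, ha₂⟩) h₂] at h
      have h3 : (a₁ : (Metric.sphere (0 : EuclideanSpace ℝ (Fin 5)) 1)) = a₂ := congrArg Subtype.val (hA'.isEmbedding.injective h)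
      exact Subtype.ext h3
  have hembA : Manifold.IsSmoothEmbedding (𝓡 4) (𝓡 4) ∞ jA :=
    ⟨himmA, (Topology.IsOpenEmbedding.of_continuous_injective_isOpenMap hcontA hinjA hopenA).isEmbedding⟩
  have hrangeA : IsOpen (range jA) := hopenA.isOpen_range
  -- the framed torus and the new tube are open smooth embeddings (composition)
  have L : (((EuclideanSpace ℝ (Fin 1)) × (EuclideanSpace ℝ (Fin 1))) × (EuclideanSpace ℝ (Fin 2))) ≃L[ℝ] (EuclideanSpace ℝ (Fin 4)) := ContinuousLinearEquiv.ofFinrankEq (by simp)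
  have hT₀o : IsOpen (range T₀) :=
    (Manifold.IsSmoothEmbedding.isOpenMap_of_finrank_eq hT₀ (by simp)).isOpen_range
  have hT₁o : IsOpen (range T₁) :=
    (Manifold.IsSmoothEmbedding.isOpenMap_of_finrank_eq hT₁ (by simp)).isOpen_range
  have hTemb := isSmoothEmbedding_comp_of_isOpen_range ν.isSmoothEmbedding ν.isOpen_range hT₀ hT₀o L
  have hjBemb := isSmoothEmbedding_comp_of_isOpen_range hB' hB'o hT₁ hT₁o L
  -- the two charts cover
  have hcovB : ∀ q : ((Metric.sphere (0 : EuclideanSpace ℝ (Fin 3)) 1)) × (EuclideanSpace ℝ (Fin 2)), jB' q ∈ range jA ∪ ⋃ i : Fin 1, range ((fun _ : Fin 1 => jB) i) :=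
      fun q => by
    by_cases hq : q ∈ S₁
    · obtain ⟨y, rfl⟩ := hq
      exact Or.inr (mem_iUnion.2 ⟨0, (y, 0), rfl⟩)
    · obtain ⟨hp, hq'⟩ := hΨΦ q hq
      have hpU : ν.toFun (Ψ q) ∈ U := hνmemU.2 hp
      exact Or.inl ⟨⟨_, hpU⟩, by rw [hjA_ν hpU, hq']⟩
  have hcover : range jA ∪ ⋃ i : Fin 1, range ((fun _ : Fin 1 => jB) i) = univ := by
    refine eq_univ_of_forall fun x => ?_
    have hx : x ∈ range jA' ∪ range jB' := hcov ▸ mem_univ x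
    rcases hx with ⟨a, rfl⟩ | ⟨q, rfl⟩
    · by_cases ha : (a : (Metric.sphere (0 : EuclideanSpace ℝ (Fin 5)) 1)) ∈ range ν.toFun
      · obtain ⟨p, hp⟩ := ha
        have hp2 : p.2 ≠ 0 := fun h0 => a.2 (by
          rw [← hp, show p = (p.1, p.2) from rfl]
          exact ν.apply_mem_range_iff.2 h0)
        have : jA' a = jB' (gluckMapInv p) := by
          rw [← hglue hp2]; congr 1; exact Subtype.ext hp.symm
        rw [this]
        exact hcovB _
      · have haU : (a : (Metric.sphere (0 : EuclideanSpace ℝ (Fin 5)) 1)) ∈ U := hmemU.2 fun hmem => ha (image_subset_range _ _ hmem)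
        refine Or.inl ⟨⟨a, haU⟩, ?_⟩
        rw [hjA_out (u := ⟨a, haU⟩) ha]
    · exact hcovB q
  -- the fibre relation
  have hrelation : ∀ (i : Fin 1) (a : U) (b : (((Metric.sphere (0 : EuclideanSpace ℝ (Fin 2)) 1)) × ((Metric.sphere (0 : EuclideanSpace ℝ (Fin 2)) 1))) × (EuclideanSpace ℝ (Fin 2))),
      (jA a = jB b ↔ ∃ θ₁ θ₂ θ₃ t : ℝ, 0 < t ∧ b = ((circlePoint θ₁, circlePoint θ₂),
        t • ((circlePoint θ₃ : (Metric.sphere (0 : EuclideanSpace ℝ (Fin 2)) 1)) : (EuclideanSpace ℝ (Fin 2)))) ∧ (a : (Metric.sphere (0 : EuclideanSpace ℝ (Fin 5)) 1)) = T ((circlePoint ((A 0 0 : ℝ) * θ₁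
        + (A 0 1 : ℝ) * θ₂ + (A 0 2 : ℝ) * θ₃), circlePoint ((A 1 0 : ℝ) * θ₁ + (A 1 1 : ℝ) * θ₂
        + (A 1 2 : ℝ) * θ₃)), t • ((circlePoint ((A 2 0 : ℝ) * θ₁ + (A 2 1 : ℝ) * θ₂
        + (A 2 2 : ℝ) * θ₃) : (Metric.sphere (0 : EuclideanSpace ℝ (Fin 2)) 1)) : (EuclideanSpace ℝ (Fin 2))))) := by
    rintro i ⟨a, haU⟩ b
    constructor
    · intro h
      by_cases ha : a ∈ range ν.toFun
      · obtain ⟨p, rfl⟩ := ha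
        have hpS : p ∉ S₀ := hνmemU.1 haU
        rw [hjA_ν haU] at h
        obtain ⟨θ₁, θ₂, θ₃, t, ht, hb, hp⟩ := (hrel p hpS b).1 (hB'.isEmbedding.injective h)
        exact ⟨θ₁, θ₂, θ₃, t, ht, hb, by show ν.toFun p = _; rw [hp]; rfl⟩
      · exfalso
        rw [hjA_out (u := ⟨a, haU⟩) ha, hjB, comp_apply, hR] at h
        exact ha ⟨_, h.2.symm⟩
    · rintro ⟨θ₁, θ₂, θ₃, t, ht, hb, ha⟩
      rw [hT, comp_apply] at ha
      subst ha
      rw [hjA_ν haU, hjB, comp_apply, (hrel _ (hνmemU.1 haU) b).2 ⟨θ₁, θ₂, θ₃, t, ht, hb, rfl⟩]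
  exact ⟨T, A, fun _ => hTemb.1, Subsingleton.pairwise, fun _ => hA, U, jA, fun _ => jB, rfl,
    hembA, hrangeA, fun _ => hjBemb, hcover, Subsingleton.pairwise, hrelation⟩

/-- **Iwase 1988, Prop. 3.5, from a model datum**: the named fact
`Iwase1988_gluckTwist_isTorusLinkSurgery` ("a Gluck twist of `S⁴` along a 2-knot is a torus
surgery on `S⁴` along one torus") follows, at every universe, from one model datum on `S² × ℝ²`
as in `isTorusLinkSurgery_of_gluckTwist_of_model`.
[cite: Iwase1988, Prop. 3.5 (proof, p. 297)] -/
theorem iwase1988_of_model (hA : A.det = 1 ∨ A.det = -1)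
    {T₀ T₁ : (((Metric.sphere (0 : EuclideanSpace ℝ (Fin 2)) 1)) × ((Metric.sphere (0 : EuclideanSpace ℝ (Fin 2)) 1))) × (EuclideanSpace ℝ (Fin 2)) → ((Metric.sphere (0 : EuclideanSpace ℝ (Fin 3)) 1)) × (EuclideanSpace ℝ (Fin 2))}
    (hT₀ : Manifold.IsSmoothEmbedding (((𝓡 1).prod (𝓡 1)).prod 𝓘(ℝ, (EuclideanSpace ℝ (Fin 2))))
      ((𝓡 2).prod 𝓘(ℝ, (EuclideanSpace ℝ (Fin 2)))) ∞ T₀)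
    (hT₁ : Manifold.IsSmoothEmbedding (((𝓡 1).prod (𝓡 1)).prod 𝓘(ℝ, (EuclideanSpace ℝ (Fin 2))))
      ((𝓡 2).prod 𝓘(ℝ, (EuclideanSpace ℝ (Fin 2)))) ∞ T₁)
    {Φ Ψ : ((Metric.sphere (0 : EuclideanSpace ℝ (Fin 3)) 1)) × (EuclideanSpace ℝ (Fin 2)) → ((Metric.sphere (0 : EuclideanSpace ℝ (Fin 3)) 1)) × (EuclideanSpace ℝ (Fin 2))}
    (hΦ : ContMDiffOn ((𝓡 2).prod 𝓘(ℝ, (EuclideanSpace ℝ (Fin 2)))) ((𝓡 2).prod 𝓘(ℝ, (EuclideanSpace ℝ (Fin 2)))) ∞ Φ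
      (range fun x : ((Metric.sphere (0 : EuclideanSpace ℝ (Fin 2)) 1)) × ((Metric.sphere (0 : EuclideanSpace ℝ (Fin 2)) 1)) => T₀ (x, 0))ᶜ)
    (hΨ : ContMDiffOn ((𝓡 2).prod 𝓘(ℝ, (EuclideanSpace ℝ (Fin 2)))) ((𝓡 2).prod 𝓘(ℝ, (EuclideanSpace ℝ (Fin 2)))) ∞ Ψ
      (range fun x : ((Metric.sphere (0 : EuclideanSpace ℝ (Fin 2)) 1)) × ((Metric.sphere (0 : EuclideanSpace ℝ (Fin 2)) 1)) => T₁ (x, 0))ᶜ)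
    (hΦΨ : ∀ p, p ∉ range (fun x : ((Metric.sphere (0 : EuclideanSpace ℝ (Fin 2)) 1)) × ((Metric.sphere (0 : EuclideanSpace ℝ (Fin 2)) 1)) => T₀ (x, 0)) →
      Φ p ∉ range (fun x : ((Metric.sphere (0 : EuclideanSpace ℝ (Fin 2)) 1)) × ((Metric.sphere (0 : EuclideanSpace ℝ (Fin 2)) 1)) => T₁ (x, 0)) ∧ Ψ (Φ p) = p)
    (hΨΦ : ∀ q, q ∉ range (fun x : ((Metric.sphere (0 : EuclideanSpace ℝ (Fin 2)) 1)) × ((Metric.sphere (0 : EuclideanSpace ℝ (Fin 2)) 1)) => T₁ (x, 0)) →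
      Ψ q ∉ range (fun x : ((Metric.sphere (0 : EuclideanSpace ℝ (Fin 2)) 1)) × ((Metric.sphere (0 : EuclideanSpace ℝ (Fin 2)) 1)) => T₀ (x, 0)) ∧ Φ (Ψ q) = q)
    (hfar : ∃ R : ℝ, ∀ p : ((Metric.sphere (0 : EuclideanSpace ℝ (Fin 3)) 1)) × (EuclideanSpace ℝ (Fin 2)), R ≤ ‖p.2‖ → Φ p = gluckMapInv p)
    (hrel : ∀ p, p ∉ range (fun x : ((Metric.sphere (0 : EuclideanSpace ℝ (Fin 2)) 1)) × ((Metric.sphere (0 : EuclideanSpace ℝ (Fin 2)) 1)) => T₀ (x, 0)) →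
      ∀ b : (((Metric.sphere (0 : EuclideanSpace ℝ (Fin 2)) 1)) × ((Metric.sphere (0 : EuclideanSpace ℝ (Fin 2)) 1))) × (EuclideanSpace ℝ (Fin 2)), (Φ p = T₁ b ↔ ∃ θ₁ θ₂ θ₃ t : ℝ, 0 < t ∧
        b = ((circlePoint θ₁, circlePoint θ₂), t • ((circlePoint θ₃ : (Metric.sphere (0 : EuclideanSpace ℝ (Fin 2)) 1)) : (EuclideanSpace ℝ (Fin 2)))) ∧
        p = T₀ ((circlePoint ((A 0 0 : ℝ) * θ₁ + (A 0 1 : ℝ) * θ₂ + (A 0 2 : ℝ) * θ₃),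
          circlePoint ((A 1 0 : ℝ) * θ₁ + (A 1 1 : ℝ) * θ₂ + (A 1 2 : ℝ) * θ₃)),
          t • ((circlePoint ((A 2 0 : ℝ) * θ₁ + (A 2 1 : ℝ) * θ₂ + (A 2 2 : ℝ) * θ₃) : (Metric.sphere (0 : EuclideanSpace ℝ (Fin 2)) 1)) :
            (EuclideanSpace ℝ (Fin 2)))))) :
    Iwase1988_gluckTwist_isTorusLinkSurgery.{u} :=
  fun _ _ _ _ _ _ _ hX =>
    isTorusLinkSurgery_of_gluckTwist_of_model hA hT₀ hT₁ hΦ hΨ hΦΨ hΨΦ hfar hrel hX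

end Reduction

end Literature.Topology.FourManifolds

end
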